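import Summits.QuantumFields.BalabanUV.Beta.GAN24.Push4LocStencil
import Summits.QuantumFields.BalabanUV.Beta.GAN24.Push4NestAux

/-!
# `BalabanUV.Beta.GAN24.Push3` — binder row G-an2-4 / (CONV-C), S-slot road «SREC» (row owner gan24-p1-g12's `SKELETON-SREC.md` v0.1 §2 SR-L1;
# RULINGS-15 (R15-1) «SREC-PUSH3»): THE THREE-LEG PUSH CARRIER `push₃ l r w S` — leaf-17's four-leg push `Push4.push₄` ONE TABLE LEG DOWN, with the
# left kernel leg, the right kernel leg and the (single) table leg read through THREE INDEPENDENT leg families; its read identity, linearity,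
# carrier (`LocStencil`) and summability bricks.  (The nesting law is the companion module `GAN24/Push3Nest`.)

NOT IN PRINT; OUR BOOKKEEPING (G-an2-4 formalisation swarm, leaf prover `b2b-balaban-gan24-formalise-leaf-01`, gen 43; the row owner's RULINGS-15 (R15-1)
invitation, journal `CLAIMS.log` l.17352, claim l.17377; names PROVISIONAL — the owner may rename / re-cut).  HONEST FRAMING (cell contract, verbatim):
«discharging `BetaPertH` makes Bałaban's UV stability UNCONDITIONAL — a real constructive-QFT result; it is NOT the continuum limit and NOT the Clay problem.»
HONEST DEPENDENCY (verbatim): «continuum YM on T⁴ ⇐ BetaPertH ∧ nine spine estimates (0/9 proved); BetaPertH ⇐ (D1) ∧ (D4) ∧ CAP+tail; G-an2-4 gates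
asym, D1 and NE2/3/4.»

WHAT.  The cubic line of the (E) recursion for the S-slot (`SrecUnits.unitS_SrecAt_succ_cubic`, p226440) pushes a stencil family `S κ u` (ONE table leg)
through a sandwich `K ∘ vertexOfK K L S κ′ u′ ∘ K` read on the coarse multiplier points (`ThirdJetKernel.e3K`).  Exactly as leaf-17's `Push4` did for the
bi-stencil tables of the W-slot, this module types the `K`-free form of that linear map ONCE, with the three legs read through three ARBITRARY leg families
`l r w : Fin (d+1) → Site → Fin (d+1) → Site → ℝ` (coarse bond → fine bond weights; `Push4Bounds.LegDecay` is their localisation predicate):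
* §1 **`push₃ l r w S κ′ u′ := ffRead (comp (comp (Lk l) (vertexW w S κ′ u′)) (Rk r))`** — left kernel leg through `l` (`Push4.Lk`), right kernel leg
  through `r` (`Push4.Rk`), the table leg through `w` (`Push4.vertexW`), the result read in the ff corner of the coarse indices (`Push4.ffRead`); entry
  formula, vanishing multiplier blocks, `IsFF`.  (leaf-12's slice push `Push4Slices.push₃ l r Y ν y′` is the instance `w = r`, definitionally.)
* §2 LINEARITY in the table (hypothesis-free): `push₃_smul`, `push₃_neg`; §2b ADDITIVITY ON THE CLASS of local stencil families (legs `LegDecay` at a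
  positive rate): `push₃_sub`, `push₃_add` — the «additive on a class» socket of leaf-01's `AffineUnroll` for the maps `S ↦ push₃ (l j) (r j) (w j) S`.
* §3 **THE READ IDENTITY** (hypothesis-free in `K`; finite fibre-sum splitting only — leaf-17's `Push4.mmRead_sandwich_eq` BY NAME): for a stencil family with
  ff-valued entries, `mmRead N (comp (comp K (vertexOfK K N S κ′ u′)) K) = push₃ (rowM K N) (colH K N) (colH K N) S κ′ u′`
  (`mmRead_sandwich_vertexOfK_eq_push₃`) — all three legs of the undressed sandwich are the `rowM`/`colH` families of `K`; the point of the three-family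
  carrier is that DRESSED instances (road «SREC» SR-L1, `RespStepBm`) read the three legs through different families.
* §4 **CARRIER**: legs localised at rate `m` from the `N`-dilated coarse point (`LegDecay`), `LocStencil S Cs δ`, `0 ≤ δ`, `2δ < m` ⟹
  `LocStencil (push₃ l r w S) (cPush₃ d C_l C_r C_w m δ · Cs) (N·δ)` (`locStencil_push₃`; the table's rate is KEPT through the table leg
  (`Push4Bounds.biLoc_vertexW_keep`) and the two kernel legs (`Push4LocStencil.abs_comp_Lk_le` / `abs_comp_Rk_le`) and DILATED by the re-indexing to the
  coarse lattice; constant displayed, linear in `Cs`, free of every level index); the undilated-rate form `locStencil_push₃_mono` (`N ≥ 1`).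
* §5 SUMMABILITY / BOUNDEDNESS bricks of the push (slices summable in the coarse bond position, entries bounded, decay in `|x′ − z′|₁`).
[folklore] throughout: one plumbing `def` (`push₃`) and one displayed constant (`cPush₃`), finite-sum / dominated-`tsum` bookkeeping over leaf-17's
`Push4` / `Push4Bounds` / `Push4LocStencil` / `Push4NestAux` BY NAME; 0 cited facts, 0 `def … : Prop`, 0 sorry.  Asserts NO shape of Bałaban's stencils;
discharges NOTHING of (hS, hSall) on (E); 0 wall binders instantiated; NEVER «G-an2-4 closed»; NOT D1, NOT BetaPertH, NOT continuum, NOT Clay.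
-/

noncomputable section

open Finset
open scoped BigOperators
open Literature.MathematicalPhysics.QuantumFieldTheory
open Literature.MathematicalPhysics.QuantumFieldTheory.Balaban1983to89
open Literature.MathematicalPhysics.QuantumFieldTheory.Balaban1983to89.Beta
open B12Sec2to5 (l1 l1_nonneg)
open ExpKernelCalculus (MKer Decays BiLoc comp Zl Zl_nonneg l1_natSmul l1_sub_symm l1_sub_triangle summable_exp_shift)
open OneStepResolventKernel (Fib wsum LocStencil biLoc_mono)
open OneStepKernelFamily (colH vertexOfK)
open BalabanStepJetsSucc (mmRead)
open BalabanCompositeJets (summable_slice_of_locStencil)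
open Summit.QuantumFields.BalabanUV.Beta.GAN24.Push4 (rowM legComp vertexW vertexW_apply vertexOfK_eq_vertexW Lk Rk ffRead IsFF isFF_ffRead
  isFF_vertexW mmRead_sandwich_eq Lk_inl_inl Lk_inl_inr Lk_inr Rk_inl_inl Rk_inr_left Rk_inr_right ffRead_inl_inl ffRead_inr_left ffRead_inr_right)
open Summit.QuantumFields.BalabanUV.Beta.GAN24.Push4Bounds (LegDecay LegDecay.nonneg LegDecay.abs_le LegDecay.summable biLoc_vertexW_keep)
open Summit.QuantumFields.BalabanUV.Beta.GAN24.Push4LocStencil (abs_ffRead_le abs_comp_Lk_le abs_comp_Rk_le)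

namespace Summit.QuantumFields.BalabanUV.Beta.GAN24.Push3

variable {d : ℕ}

/-! ## §1 The three-leg push -/

/-- [our object] **THE THREE-LEG PUSH** of a stencil family `S` through the leg families `(l, r, w)`: the TABLE leg read through `w` (`vertexW w S κ′ u′`),
the LEFT kernel leg through `l` (`Lk l`), the RIGHT kernel leg through `r` (`Rk r`), the result read in the ff corner of the coarse indices —
`push₃ l r w S κ′ u′ := ffRead (comp (comp (Lk l) (vertexW w S κ′ u′)) (Rk r))`.  For `(l, r, w) = (rowM K N, colH K N, colH K N)` and ff-valued `S`
this IS `mmRead N (K ∘ vertexOfK K N S κ′ u′ ∘ K)` (§3).  A definition asserting nothing. -/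
def push₃ (l r w : Fin (d + 1) → (Fin (d + 1) → ℤ) → Fin (d + 1) → (Fin (d + 1) → ℤ) → ℝ)
    (S : Fin (d + 1) → (Fin (d + 1) → ℤ) → MKer (d + 1) (Fib d)) (κ' : Fin (d + 1)) (u' : Fin (d + 1) → ℤ) : MKer (d + 1) (Fib d) :=
  ffRead (comp (comp (Lk l) (vertexW w S κ' u')) (Rk r))

variable (l r w : Fin (d + 1) → (Fin (d + 1) → ℤ) → Fin (d + 1) → (Fin (d + 1) → ℤ) → ℝ)

/-- [folklore] `push₃`, by `rfl`. -/
theorem push₃_def (S : Fin (d + 1) → (Fin (d + 1) → ℤ) → MKer (d + 1) (Fib d)) (κ' : Fin (d + 1)) (u' : Fin (d + 1) → ℤ) :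
    push₃ l r w S κ' u' = ffRead (comp (comp (Lk l) (vertexW w S κ' u')) (Rk r)) := rfl

/-- [folklore] **THE ENTRY FORMULA** of the push: for field indices,
`push₃ l r w S κ′ u′ x′ z′ (inl α) (inl β) = Σ'_z Σ_{κ₂} (Σ'_x Σ_{κ₁} l α x′ κ₁ x · (vertexW w S κ′ u′) x z (inl κ₁) (inl κ₂)) · r β z′ κ₂ z`. -/
theorem push₃_inl_inl (S : Fin (d + 1) → (Fin (d + 1) → ℤ) → MKer (d + 1) (Fib d)) (κ' : Fin (d + 1)) (u' : Fin (d + 1) → ℤ)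
    (x' z' : Fin (d + 1) → ℤ) (α β : Fin (d + 1)) :
    push₃ l r w S κ' u' x' z' (Sum.inl α) (Sum.inl β)
      = ∑' z : Fin (d + 1) → ℤ, ∑ κ₂ : Fin (d + 1),
          (∑' x : Fin (d + 1) → ℤ, ∑ κ₁ : Fin (d + 1), l α x' κ₁ x * vertexW w S κ' u' x z (Sum.inl κ₁) (Sum.inl κ₂)) * r β z' κ₂ z := by
  simp only [push₃, ffRead_inl_inl, comp]
  refine tsum_congr fun z => ?_
  rw [Fintype.sum_sum_type]
  simp only [Rk_inl_inl, Rk_inr_left, mul_zero, Finset.sum_const_zero, add_zero]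
  refine Finset.sum_congr rfl fun κ₂ _ => ?_
  congr 1
  refine tsum_congr fun x => ?_
  rw [Fintype.sum_sum_type]
  simp only [Lk_inl_inl, Lk_inl_inr, zero_mul, Finset.sum_const_zero, add_zero]

/-- [folklore] `push₃`: multiplier rows vanish. -/
@[simp] theorem push₃_inr_left (S : Fin (d + 1) → (Fin (d + 1) → ℤ) → MKer (d + 1) (Fib d)) (κ' : Fin (d + 1)) (u' : Fin (d + 1) → ℤ)
    (x' z' : Fin (d + 1) → ℤ) (μ : Fin (d + 1)) (b : Fib d) : push₃ l r w S κ' u' x' z' (Sum.inr μ) b = 0 := by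
  simp only [push₃, ffRead_inr_left]

/-- [folklore] `push₃`: multiplier columns vanish. -/
@[simp] theorem push₃_inr_right (S : Fin (d + 1) → (Fin (d + 1) → ℤ) → MKer (d + 1) (Fib d)) (κ' : Fin (d + 1)) (u' : Fin (d + 1) → ℤ)
    (x' z' : Fin (d + 1) → ℤ) (a : Fib d) (ν : Fin (d + 1)) : push₃ l r w S κ' u' x' z' a (Sum.inr ν) = 0 := by
  simp only [push₃, ffRead_inr_right]

/-- [folklore] `push₃ l r w S κ′ u′` is ff-valued (whatever `S` is): the push of any stencil family is again a family of ff-valued kernels, indexed by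
the COARSE bonds `(κ′, u′)`. -/
theorem isFF_push₃ (S : Fin (d + 1) → (Fin (d + 1) → ℤ) → MKer (d + 1) (Fib d)) (κ' : Fin (d + 1)) (u' : Fin (d + 1) → ℤ) :
    IsFF (push₃ l r w S κ' u') :=
  isFF_ffRead _

/-! ## §2 Linearity in the table (hypothesis-free) -/

/-- [folklore] `vertexW` is homogeneous in the stencil family (`tsum_mul_left`, unconditional). -/
theorem vertexW_smul (c : ℝ) (S : Fin (d + 1) → (Fin (d + 1) → ℤ) → MKer (d + 1) (Fib d)) (κ' : Fin (d + 1)) (u' : Fin (d + 1) → ℤ) :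
    vertexW w (fun κ u => c • S κ u) κ' u' = c • vertexW w S κ' u' := by
  funext x z a b
  simp only [vertexW_apply, Pi.smul_apply, smul_eq_mul, Finset.mul_sum]
  refine Finset.sum_congr rfl fun κ _ => ?_
  rw [← tsum_mul_left]
  exact tsum_congr fun u => by ring

/-- [folklore] `ffRead` is homogeneous. -/
theorem ffRead_smul (c : ℝ) (W : MKer (d + 1) (Fib d)) : ffRead (c • W) = c • ffRead W := by
  funext x z a b
  rcases a with α | μ
  · rcases b with β | ν
    · simp only [ffRead_inl_inl, Pi.smul_apply, smul_eq_mul]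
    · simp only [ffRead_inr_right, Pi.smul_apply, smul_eq_mul, mul_zero]
  · simp only [ffRead_inr_left, Pi.smul_apply, smul_eq_mul, mul_zero]

/-- [folklore] **`push₃` IS HOMOGENEOUS IN THE TABLE**: a scalar weight on the stencil family factors out (no hypothesis). -/
theorem push₃_smul (c : ℝ) (S : Fin (d + 1) → (Fin (d + 1) → ℤ) → MKer (d + 1) (Fib d)) (κ' : Fin (d + 1)) (u' : Fin (d + 1) → ℤ) :
    push₃ l r w (fun κ u => c • S κ u) κ' u' = c • push₃ l r w S κ' u' := by
  rw [push₃_def, push₃_def, vertexW_smul, KernelReflection.comp_smul_right, KernelReflection.comp_smul_left, ffRead_smul]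

/-- [folklore] `push₃` of the negated table is the negated push (no hypothesis). -/
theorem push₃_neg (S : Fin (d + 1) → (Fin (d + 1) → ℤ) → MKer (d + 1) (Fib d)) (κ' : Fin (d + 1)) (u' : Fin (d + 1) → ℤ) :
    push₃ l r w (fun κ u => -S κ u) κ' u' = -push₃ l r w S κ' u' := by
  have h := push₃_smul l r w (-1) S κ' u'
  simp only [neg_one_smul] at h
  exact h

/-! ## §2b Additivity in the table ON THE CLASS of local stencil families (the socket of `AffineUnroll`'s «additive on a class») -/

variable {l r w}

/-- [folklore] `vertexW` of a difference is the difference, for BOUNDED table-leg weights and stencil families with SUMMABLE slices (`tsum_sub`). -/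
theorem vertexW_sub {Cw : ℝ} (hw : ∀ κ' u' κ u, |w κ' u' κ u| ≤ Cw) {S S' : Fin (d + 1) → (Fin (d + 1) → ℤ) → MKer (d + 1) (Fib d)}
    (hS : ∀ κ x z a b, Summable fun u => S κ u x z a b) (hS' : ∀ κ x z a b, Summable fun u => S' κ u x z a b) (κ' : Fin (d + 1))
    (u' : Fin (d + 1) → ℤ) : vertexW w (fun κ u => S κ u - S' κ u) κ' u' = vertexW w S κ' u' - vertexW w S' κ' u' := by
  funext x z a b
  simp only [vertexW_apply, Pi.sub_apply, ← Finset.sum_sub_distrib]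
  refine Finset.sum_congr rfl fun κ _ => ?_
  rw [← (KKTFluctuationEnergy.summable_mul_of_bdd (fun u => hw κ' u' κ u) (hS κ x z a b)).tsum_sub
    (KKTFluctuationEnergy.summable_mul_of_bdd (fun u => hw κ' u' κ u) (hS' κ x z a b))]
  exact tsum_congr fun u => by ring

/-- [folklore] `ffRead` of a difference is the difference (pointwise; no hypothesis). -/
theorem ffRead_sub (W W' : MKer (d + 1) (Fib d)) : ffRead (W - W') = ffRead W - ffRead W' := by
  funext x z a b
  rcases a with α | μ
  · rcases b with β | ν
    · simp only [ffRead_inl_inl, Pi.sub_apply]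
    · simp only [ffRead_inr_right, Pi.sub_apply, sub_zero]
  · simp only [ffRead_inr_left, Pi.sub_apply, sub_zero]

/-- [folklore] **`push₃` IS ADDITIVE ON THE CLASS OF LOCAL STENCIL FAMILIES — DIFFERENCE FORM**: for leg families localised at a positive rate
(`LegDecay`, any blocking `N`, any constants) and two local stencil families at positive rates,
`push₃ l r w (S − S′) κ′ u′ = push₃ l r w S κ′ u′ − push₃ l r w S′ κ′ u′`.  (The three `tsum`s are split under the exponential majorants of the
hypotheses — `KernelWard.comp_sub_left/right`; the form in which the (hSall)-type Cauchy differences and `AffineUnroll.diff_succ` consume it.) -/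
theorem push₃_sub {N : ℕ} {Cl Cr Cw m Cs Cs' δ δ' : ℝ} (hl : LegDecay l N Cl m) (hr : LegDecay r N Cr m) (hw : LegDecay w N Cw m) (hm : 0 < m)
    {S S' : Fin (d + 1) → (Fin (d + 1) → ℤ) → MKer (d + 1) (Fib d)} (hS : LocStencil S Cs δ) (hS' : LocStencil S' Cs' δ') (hδ : 0 < δ)
    (hδ' : 0 < δ') (κ' : Fin (d + 1)) (u' : Fin (d + 1) → ℤ) :
    push₃ l r w (fun κ u => S κ u - S' κ u) κ' u' = push₃ l r w S κ' u' - push₃ l r w S' κ' u' := by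
  have hCl := hl.nonneg
  have hCw := hw.nonneg
  have hlb : ∀ α x' κ x, |l α x' κ x| ≤ Cl := fun α x' κ x => hl.abs_le hm.le α x' κ x
  have hwb : ∀ μ y κ u, |w μ y κ u| ≤ Cw := fun μ y κ u => hw.abs_le hm.le μ y κ u
  have hls : ∀ α x' κ, Summable fun x => l α x' κ x := fun α x' κ => hl.summable hm α x' κ
  have hrs : ∀ β z' κ, Summable fun z => r β z' κ z := fun β z' κ => hr.summable hm β z' κ
  -- the two table vertices decay, hence are bounded; the left leg kernel against them is bounded
  have hV := Push4NestAux.decays_vertexW_of_locStencil hwb hCw hS hδ κ' u'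
  have hV' := Push4NestAux.decays_vertexW_of_locStencil hwb hCw hS' hδ' κ' u'
  have sL : ∀ (V : MKer (d + 1) (Fib d)) (CV : ℝ), (∀ y z f b, |V y z f b| ≤ CV) →
      ∀ x z a b, Summable fun y : Fin (d + 1) → ℤ => ∑ f, Lk l x y a f * V y z f b := fun V CV hVb x z a b =>
    summable_sum fun f _ => KKTFluctuationEnergy.summable_mul_of_bdd' (Push4NestAux.summable_Lk_row hls x a f) (fun y => hVb y z f b)
  have sR : ∀ (M : MKer (d + 1) (Fib d)) (CM : ℝ), (∀ x y a g, |M x y a g| ≤ CM) →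
      ∀ x z a b, Summable fun y : Fin (d + 1) → ℤ => ∑ g, M x y a g * Rk r y z g b := fun M CM hMb x z a b =>
    summable_sum fun g _ => KKTFluctuationEnergy.summable_mul_of_bdd (fun y => hMb x y a g) (Push4NestAux.summable_Rk_col hrs z g b)
  rw [push₃_def, push₃_def, push₃_def,
    vertexW_sub hwb (fun κ x z a b => summable_slice_of_locStencil hS hδ κ x z a b)
      (fun κ x z a b => summable_slice_of_locStencil hS' hδ' κ x z a b) κ' u',
    KernelWard.comp_sub_right (sL _ _ fun y z f b => Push4NestAux.abs_le_of_decays hV (half_pos hδ).le y z f b)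
      (sL _ _ fun y z f b => Push4NestAux.abs_le_of_decays hV' (half_pos hδ').le y z f b),
    KernelWard.comp_sub_left (sR _ _ fun x y a g => Push4NestAux.abs_comp_Lk_le_of_decays hlb hCl hV (half_pos hδ) x y a g)
      (sR _ _ fun x y a g => Push4NestAux.abs_comp_Lk_le_of_decays hlb hCl hV' (half_pos hδ') x y a g),
    ffRead_sub]

/-- [folklore] A local stencil family stays local under negation (same constant, same rate). -/
theorem locStencil_neg {S : Fin (d + 1) → (Fin (d + 1) → ℤ) → MKer (d + 1) (Fib d)} {Cs δ : ℝ} (hS : LocStencil S Cs δ) :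
    LocStencil (fun κ u => -S κ u) Cs δ := by
  intro κ u x z a b
  have h := hS κ u x z a b
  simp only [Pi.neg_apply, abs_neg]
  exact h

/-- [folklore] **`push₃` IS ADDITIVE ON THE CLASS OF LOCAL STENCIL FAMILIES**: for leg families localised at a positive rate and two local stencil
families at positive rates, `push₃ l r w (S + S′) κ′ u′ = push₃ l r w S κ′ u′ + push₃ l r w S′ κ′ u′` — the «additive on a class» socket of
leaf-01's `AffineUnroll` (`transport_add`, `eq_transport_add_sum`) for the maps `S ↦ push₃ (l j) (r j) (w j) S`. -/
theorem push₃_add {N : ℕ} {Cl Cr Cw m Cs Cs' δ δ' : ℝ} (hl : LegDecay l N Cl m) (hr : LegDecay r N Cr m) (hw : LegDecay w N Cw m) (hm : 0 < m)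
    {S S' : Fin (d + 1) → (Fin (d + 1) → ℤ) → MKer (d + 1) (Fib d)} (hS : LocStencil S Cs δ) (hS' : LocStencil S' Cs' δ') (hδ : 0 < δ)
    (hδ' : 0 < δ') (κ' : Fin (d + 1)) (u' : Fin (d + 1) → ℤ) :
    push₃ l r w (fun κ u => S κ u + S' κ u) κ' u' = push₃ l r w S κ' u' + push₃ l r w S' κ' u' := by
  have e : (fun κ u => S κ u + S' κ u) = fun κ u => S κ u - (fun κ u => -S' κ u) κ u := by
    funext κ u; simp only [sub_neg_eq_add]
  rw [e, push₃_sub hl hr hw hm hS (locStencil_neg hS') hδ hδ' κ' u', push₃_neg, sub_neg_eq_add]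

variable (l r w)

/-! ## §3 THE READ IDENTITY: the `mm`-read of the sandwich of a chain-rule vertex is a three-leg push -/

/-- [folklore] **THE LINEAR MAP `S ↦ mmRead N (K ∘ vertexOfK K N S κ′ u′ ∘ K)` IS A THREE-LEG PUSH**: for every packed kernel `K`, every blocking `N`
and every stencil family `S` WITH ff-VALUED ENTRIES,
`mmRead N (comp (comp K (vertexOfK K N S κ′ u′)) K) = push₃ (rowM K N) (colH K N) (colH K N) S κ′ u′`
— hypothesis-free in `K` (no decay, no summability: leaf-17's `Push4.mmRead_sandwich_eq` + `vertexOfK_eq_vertexW`).  With the sign of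
`ThirdJetKernel.e3K K N S κ′ u′ := −mmRead N (…)` this is `e3K K N S κ′ u′ = −push₃ (rowM K N) (colH K N) (colH K N) S κ′ u′` on ff-valued families
(the instantiation to the dressed literal is road «SREC» SR-L1's `SrecLinearPartEq`, not here). -/
theorem mmRead_sandwich_vertexOfK_eq_push₃ (K : MKer (d + 1) (Fib d)) (N : ℕ)
    {S : Fin (d + 1) → (Fin (d + 1) → ℤ) → MKer (d + 1) (Fib d)} (hS : ∀ κ u, IsFF (S κ u)) (κ' : Fin (d + 1)) (u' : Fin (d + 1) → ℤ) :
    mmRead N (comp (comp K (vertexOfK K N S κ' u')) K) = push₃ (rowM K N) (colH K N) (colH K N) S κ' u' := by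
  rw [vertexOfK_eq_vertexW, mmRead_sandwich_eq K N (isFF_vertexW (colH K N) hS κ' u'), push₃_def]

/-- [folklore] The same with the minus sign of the third-jet functional displayed:
`-mmRead N (K ∘ vertexOfK K N S κ′ u′ ∘ K) = push₃ (rowM K N) (colH K N) (colH K N) (−S) κ′ u′` for ff-valued `S`. -/
theorem neg_mmRead_sandwich_vertexOfK_eq_push₃ (K : MKer (d + 1) (Fib d)) (N : ℕ)
    {S : Fin (d + 1) → (Fin (d + 1) → ℤ) → MKer (d + 1) (Fib d)} (hS : ∀ κ u, IsFF (S κ u)) (κ' : Fin (d + 1)) (u' : Fin (d + 1) → ℤ) :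
    -mmRead N (comp (comp K (vertexOfK K N S κ' u')) K) = push₃ (rowM K N) (colH K N) (colH K N) (fun κ u => -S κ u) κ' u' := by
  rw [push₃_neg, mmRead_sandwich_vertexOfK_eq_push₃ K N hS]

/-! ## §4 CARRIER: the push of a local stencil family through localised legs is a local stencil family on the coarse lattice -/

variable {l r w}
variable {N : ℕ} {Cl Cr Cw Cs m δ : ℝ} {S : Fin (d + 1) → (Fin (d + 1) → ℤ) → MKer (d + 1) (Fib d)}

/-- [folklore] THE CONSTANT of `locStencil_push₃`: `(d+1)³·C_l·C_r·C_w·Zl(m−δ)²·Zl(m−2δ)` (explicit; free of every level index; the bound is LINEAR in the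
table's constant `Cs`). -/
def cPush₃ (d : ℕ) (Cl Cr Cw m δ : ℝ) : ℝ :=
  ((d + 1 : ℕ) : ℝ) ^ 3 * Cl * Cr * Cw * Zl (d + 1) (m - δ) ^ 2 * Zl (d + 1) (m - 2 * δ)

/-- [folklore] `cPush₃` is nonnegative for nonnegative leg constants and `m > 2δ ≥ 0`. -/
theorem cPush₃_nonneg (hCl : 0 ≤ Cl) (hCr : 0 ≤ Cr) (hCw : 0 ≤ Cw) (hδ : 0 ≤ δ) (hm : 2 * δ < m) : 0 ≤ cPush₃ d Cl Cr Cw m δ := by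
  unfold cPush₃
  have := Zl_nonneg (D := d + 1) (show 0 < m - δ by linarith)
  have := Zl_nonneg (D := d + 1) (show 0 < m - 2 * δ by linarith)
  positivity

/-- [folklore] **THE PUSH AT THE DILATED COARSE POINT** (one coarse bond): legs `l`, `r`, `w` localised at rate `m` from the `N`-dilated coarse point, a local
stencil family `S` at rate `δ` with `0 ≤ δ`, `2δ < m` ⟹ `push₃ l r w S κ′ u′` is bi-localised at `u′` ON THE COARSE LATTICE at the DILATED rate `N·δ`
with the constant `cPush₃ d C_l C_r C_w m δ · Cs`. -/
theorem biLoc_push₃ (hl : LegDecay l N Cl m) (hr : LegDecay r N Cr m) (hw : LegDecay w N Cw m) (hS : LocStencil S Cs δ)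
    (hδ : 0 ≤ δ) (hm : 2 * δ < m) (κ' : Fin (d + 1)) (u' : Fin (d + 1) → ℤ) :
    BiLoc (push₃ l r w S κ' u') u' u' (cPush₃ d Cl Cr Cw m δ * Cs) ((N : ℝ) * δ) := by
  intro x' z' a b
  have hCs : 0 ≤ Cs := (hS 0 0).nonneg (Sum.inl 0)
  have hCl := hl.nonneg
  have hCr := hr.nonneg
  have hCw := hw.nonneg
  have hZ1 : 0 ≤ Zl (d + 1) (m - δ) := Zl_nonneg (by linarith)
  have hZ2 : 0 ≤ Zl (d + 1) (m - 2 * δ) := Zl_nonneg (by linarith)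
  -- the table leg (kept rate)
  have hW := biLoc_vertexW_keep hw hS hδ hm κ' u'
  -- the left kernel leg
  have hM := abs_comp_Lk_le hl hW hδ (by linarith)
  -- the right kernel leg
  have hK₁ : 0 ≤ (d + 1 : ℕ) * (Cl * ((d + 1 : ℕ) * (Cw * Cs * Zl (d + 1) (m - 2 * δ))) * Zl (d + 1) (m - δ)) := by positivity
  have hP := abs_comp_Rk_le hr hK₁ hM hδ (by linarith) x' z' a b
  rw [push₃_def]
  refine (abs_ffRead_le _ x' z' a b).trans (hP.trans (le_of_eq ?_))
  -- dilation bookkeeping: every distance on the coarse lattice is an `N`-dilated fine distance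
  have e2 : l1 ((N : ℤ) • x' - (N : ℤ) • u') = (N : ℝ) * l1 (x' - u') := by rw [← smul_sub, l1_natSmul]
  have e3 : l1 ((N : ℤ) • z' - (N : ℤ) • u') = (N : ℝ) * l1 (z' - u') := by rw [← smul_sub, l1_natSmul]
  rw [e2, e3]
  have hE2 : Real.exp (-δ * ((N : ℝ) * l1 (x' - u') + (N : ℝ) * l1 (z' - u')))
      = Real.exp (-((N : ℝ) * δ) * (l1 (x' - u') + l1 (z' - u'))) := by congr 1; ring
  rw [hE2, cPush₃]
  ring

/-- [folklore] **THE THREE-LEG PUSH IS A `LocStencil` FAMILY AT THE DILATED RATE.**  Leg families `l`, `r`, `w` localised at rate `m` from the `N`-dilated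
coarse point, a local stencil family `S` at rate `δ` with `0 ≤ δ` and `2δ < m` ⟹ `LocStencil (push₃ l r w S) (cPush₃ d C_l C_r C_w m δ · Cs) (N·δ)` — the
table's rate is KEPT through the table leg and the two kernel legs and DILATED by the re-indexing to the coarse lattice (`l1 (N•z) = N·l1 z`); ONE
constant for every member, linear in `Cs`.  (The one-step shape statement for a single push; for the composite push the legs are `legComp`-chains,
`Push3Nest`.) -/
theorem locStencil_push₃ (hl : LegDecay l N Cl m) (hr : LegDecay r N Cr m) (hw : LegDecay w N Cw m) (hS : LocStencil S Cs δ)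
    (hδ : 0 ≤ δ) (hm : 2 * δ < m) : LocStencil (push₃ l r w S) (cPush₃ d Cl Cr Cw m δ * Cs) ((N : ℝ) * δ) :=
  fun κ' u' => biLoc_push₃ hl hr hw hS hδ hm κ' u'

/-- [folklore] The same at the UNDILATED rate `δ` (`N ≥ 1`). -/
theorem locStencil_push₃_mono (hN : 1 ≤ N) (hl : LegDecay l N Cl m) (hr : LegDecay r N Cr m) (hw : LegDecay w N Cw m)
    (hS : LocStencil S Cs δ) (hδ : 0 ≤ δ) (hm : 2 * δ < m) : LocStencil (push₃ l r w S) (cPush₃ d Cl Cr Cw m δ * Cs) δ := by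
  have hCs : 0 ≤ Cs := (hS 0 0).nonneg (Sum.inl 0)
  have hC : 0 ≤ cPush₃ d Cl Cr Cw m δ * Cs := mul_nonneg (cPush₃_nonneg hl.nonneg hr.nonneg hw.nonneg hδ hm) hCs
  have h1 : (1 : ℝ) ≤ N := by exact_mod_cast hN
  have hle : δ ≤ (N : ℝ) * δ := by nlinarith
  exact fun κ' u' => biLoc_mono (biLoc_push₃ hl hr hw hS hδ hm κ' u') hC hle

/-! ## §5 Summability and boundedness of the push -/

/-- [folklore] **UNIFORM BOUND**: every entry of the push is bounded by the carrier constant. -/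
theorem abs_push₃_le (hl : LegDecay l N Cl m) (hr : LegDecay r N Cr m) (hw : LegDecay w N Cw m) (hS : LocStencil S Cs δ)
    (hδ : 0 ≤ δ) (hm : 2 * δ < m) (κ' : Fin (d + 1)) (u' x' z' : Fin (d + 1) → ℤ) (a b : Fib d) :
    |push₃ l r w S κ' u' x' z' a b| ≤ cPush₃ d Cl Cr Cw m δ * Cs := by
  have hCs : 0 ≤ Cs := (hS 0 0).nonneg (Sum.inl 0)
  have hC : 0 ≤ cPush₃ d Cl Cr Cw m δ * Cs := mul_nonneg (cPush₃_nonneg hl.nonneg hr.nonneg hw.nonneg hδ hm) hCs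
  refine (biLoc_push₃ hl hr hw hS hδ hm κ' u' x' z' a b).trans ?_
  have hexp : Real.exp (-((N : ℝ) * δ) * (l1 (x' - u') + l1 (z' - u'))) ≤ 1 := by
    rw [Real.exp_le_one_iff]
    have hN : (0 : ℝ) ≤ N := Nat.cast_nonneg _
    nlinarith [l1_nonneg (x' - u'), l1_nonneg (z' - u'), mul_nonneg hN hδ]
  nlinarith

/-- [folklore] **SUMMABLE SLICES**: for `N ≥ 1` and a table rate `δ > 0` every slice `u′ ↦ push₃ l r w S κ′ u′ x′ z′ a b` of the push is summable in the
coarse bond position (the hypothesis `Push4NestTable.vertexW_vertexW` asks of an inner table — so pushes can be pushed). -/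
theorem summable_push₃_slice (hN : 1 ≤ N) (hl : LegDecay l N Cl m) (hr : LegDecay r N Cr m) (hw : LegDecay w N Cw m)
    (hS : LocStencil S Cs δ) (hδ : 0 < δ) (hm : 2 * δ < m) (κ' : Fin (d + 1)) (x' z' : Fin (d + 1) → ℤ) (a b : Fib d) :
    Summable fun u' => push₃ l r w S κ' u' x' z' a b :=
  summable_slice_of_locStencil (locStencil_push₃_mono hN hl hr hw hS hδ.le hm) hδ κ' x' z' a b

/-- [folklore] **DECAY IN THE COARSE INDICES**: for `N ≥ 1` the push decays in `|x′ − z′|₁` at the table's rate (`|x′−u′|₁ + |z′−u′|₁ ≥ |x′−z′|₁`). -/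
theorem decays_push₃ (hN : 1 ≤ N) (hl : LegDecay l N Cl m) (hr : LegDecay r N Cr m) (hw : LegDecay w N Cw m)
    (hS : LocStencil S Cs δ) (hδ : 0 ≤ δ) (hm : 2 * δ < m) (κ' : Fin (d + 1)) (u' : Fin (d + 1) → ℤ) :
    Decays (push₃ l r w S κ' u') (cPush₃ d Cl Cr Cw m δ * Cs) δ := by
  intro x' z' a b
  have hCs : 0 ≤ Cs := (hS 0 0).nonneg (Sum.inl 0)
  have hC : 0 ≤ cPush₃ d Cl Cr Cw m δ * Cs := mul_nonneg (cPush₃_nonneg hl.nonneg hr.nonneg hw.nonneg hδ hm) hCs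
  refine (locStencil_push₃_mono hN hl hr hw hS hδ hm κ' u' x' z' a b).trans (mul_le_mul_of_nonneg_left (Real.exp_le_exp.2 ?_) hC)
  have t := l1_sub_triangle x' u' z'
  rw [l1_sub_symm u' z'] at t
  nlinarith

end Summit.QuantumFields.BalabanUV.Beta.GAN24.Push3

end
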